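import Summits.Ventures.CertifiedManyBodySolver.Downfold.BoxesLa214TpLadderSigmaFS
import Summits.Ventures.CertifiedManyBodySolver.Downfold.EmeryFermiFillingLSCO
import HarnessLib

/-!
# `t′` ladder of La₂₋ₓSrₓCuO₄ (box #18), part 4b: the BY-NAME ties of part 4's typed windows W13 / W15 / SC / WC to mod-4's kernel words
# (`EmeryFermiFillingLa214`, `EmeryFermiFillingLSCO`), and the words they yield on the typed ladder rows (E, γ) of the companion box

Venture CertifiedManyBodySolver, cell `pub/hubbard-downfold` (D-0154 (1)(C) COVERAGE, La214 TEMPLATE material; seat `hubbard-cov-la214-unc-3`, seventh seat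
(`prover-hubbard-cov-la214-unc-3-g6-0`), lane `t′`); namespace `Summit.Ventures.CertifiedManyBodySolver.Downfold`. Split off part 4 (`BoxesLa214TpLadderSigmaFS`)
only because it must import the device's box-level files; everything here is PROVED and each tie is ONE application of a mod-4 word:
* §1 at every parameter vector of the typed three-band companion of record `emeryBoxLa214v123` and every Fermi energy carrying the column's electron count,
  the σ-model Fermi-surface ratio `Emery.fsRatio` is a member of part 4's entry `la214_M13_tp_sigmaFS = [−591/2000, −1653/10000]` (both filling forms; also on
  `emeryBoxLa214v122` / `emeryBoxLa214` by mod-4's own transfers) and, on `emeryBoxLa214M15v123` (x = 1/8), of `la214_M15_tp_sigmaFS = [−741/2500, −1661/10000]`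
  (also on `emeryBoxLa214M15v122` / `emeryBoxLa214M15`) — so the literals of part 4 are the kernel's, not a transcription;
* §2 on the two named corner sub-boxes (raw coordinates, M13 filling row) BOTH the corner word and the box word hold: strong corner ⇒ `fsRatio ∈ SC ∩ W13 =
  [−591/2000, −1241/5000]` and it IS an object-E value (`la214E_M13v19_tp.Mem`); weak corner ⇒ `fsRatio ∈ WC ∩ W13 = [−197/1000, −1653/10000]`, NOT an
  object-E value, but γ-admissible and at or above the literature object-M row's low end `−9/50` whenever `≥ −9/50` … (placement by part 4 §2);
* §3 THE WORDS ON THE LADDER ROWS that follow by composing with part 4: on the whole companion at n_H = 1 every σ-model FS ratio is γ-ADMISSIBLE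
  (`la214G_tp_row.Mem`), is an object-E value IFF it is `≤ −1/5`, and never lies in the E row's FLOOR sliver below `−591/2000` nor at the M2(b) station `−3/10`.
HONEST FRAMING: SCREENING-GRADE companion box; the device certifies the reduction step of the σ model only (mod-4's words); no box row, END, FLOOR, word, bar,
leaf, node or coverage statement moves; no phase sentence; nothing about La₂CuO₄ samples; no summit statement is proved by this seat.
References: three-band model [HybertsenSchluterChristensen1989, Eq. (1)].
-/

noncomputable section

namespace Summit.Ventures.CertifiedManyBodySolver.Downfold

open Set NonemptyInterval

/-! ## §1 Box-level ties: W13 on the companion of record (x = 0), W15 on the x = 1/8 box -/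

/-- **BY-NAME TIE, W13, hole-count form**: mod-4's kernel word `Emery.emeryBoxLa214v123_fsRatio_window_nH` says exactly that the σ-model Fermi-surface ratio lies
in the typed entry `la214_M13_tp_sigmaFS` at every parameter vector of `emeryBoxLa214v123` and every Fermi energy carrying the box's electron count (n_H = 1).
[cite: HybertsenSchluterChristensen1989, Eq. (1) (three-band d–p model)] -/
theorem la214_M13_tp_sigmaFS_of_certificate :
    HoldsOn (fun p : EmeryCoord → ℝ => ∀ ε : ℝ,
      Emery.abFilling (p .DeltaPd) (p .tpd) (p .tpp) (p .tppP) ε = (2 - p .nHoles) / 2 →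
      la214_M13_tp_sigmaFS.Mem (Emery.fsRatio (p .DeltaPd) (p .tpd) (p .tpp) (p .tppP) ε)) emeryBoxLa214v123 := by
  intro p hp ε hf
  have h := Emery.emeryBoxLa214v123_fsRatio_window_nH p hp ε hf
  refine (Entry.mem_ofEnds_iff _ _ _ _ _).2 ⟨?_, ?_⟩
  · have h1 := h.1
    push_cast
    linarith
  · have h2 := h.2
    push_cast
    linarith

/-- **BY-NAME TIE, W13, filling-row form** (`Emery.emeryBoxLa214v123_fsRatio_window`: per-spin filling ∈ [99/200, 101/200] = the M13 density row), and the same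
on the v1.22 edition `emeryBoxLa214v122` and the older `emeryBoxLa214` (mod-4's `Emery.emeryBoxLa214v122_fsRatio_window` / `Emery.emeryBoxLa214_fsRatio_window`).
[cite: HybertsenSchluterChristensen1989, Eq. (1) (three-band d–p model)] -/
theorem la214_M13_tp_sigmaFS_of_certificate_filling :
    HoldsOn (fun p : EmeryCoord → ℝ => ∀ ε : ℝ,
        Emery.abFilling (p .DeltaPd) (p .tpd) (p .tpp) (p .tppP) ε ∈ Set.Icc (99 / 200 : ℝ) (101 / 200) →
        la214_M13_tp_sigmaFS.Mem (Emery.fsRatio (p .DeltaPd) (p .tpd) (p .tpp) (p .tppP) ε)) emeryBoxLa214v123 ∧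
      HoldsOn (fun p : EmeryCoord → ℝ => ∀ ε : ℝ,
        Emery.abFilling (p .DeltaPd) (p .tpd) (p .tpp) (p .tppP) ε ∈ Set.Icc (99 / 200 : ℝ) (101 / 200) →
        la214_M13_tp_sigmaFS.Mem (Emery.fsRatio (p .DeltaPd) (p .tpd) (p .tpp) (p .tppP) ε)) emeryBoxLa214v122 ∧
      HoldsOn (fun p : EmeryCoord → ℝ => ∀ ε : ℝ,
        Emery.abFilling (p .DeltaPd) (p .tpd) (p .tpp) (p .tppP) ε ∈ Set.Icc (99 / 200 : ℝ) (101 / 200) →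
        la214_M13_tp_sigmaFS.Mem (Emery.fsRatio (p .DeltaPd) (p .tpd) (p .tpp) (p .tppP) ε)) emeryBoxLa214 := by
  have key : ∀ {r : ℝ}, r ∈ Set.Icc (-(591 / 2000 : ℝ)) (-(1653 / 10000 : ℝ)) → la214_M13_tp_sigmaFS.Mem r := by
    intro r hr
    refine (Entry.mem_ofEnds_iff _ _ _ _ _).2 ⟨?_, ?_⟩
    · have h1 := hr.1
      push_cast
      linarith
    · have h2 := hr.2
      push_cast
      linarith
  exact ⟨fun p hp ε hν => key (Emery.emeryBoxLa214v123_fsRatio_window p hp ε hν),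
    fun p hp ε hν => key (Emery.emeryBoxLa214v122_fsRatio_window p hp ε hν),
    fun p hp ε hν => key (Emery.emeryBoxLa214_fsRatio_window p hp ε hν)⟩

/-- **BY-NAME TIE, W15** (x = 1/8): mod-4's `Emery.emeryBoxLa214M15v123_fsRatio_window` says the σ-model Fermi-surface ratio lies in `la214_M15_tp_sigmaFS` at every
parameter vector of `emeryBoxLa214M15v123` and every Fermi energy carrying that box's electron count (n_H ∈ [1.105, 1.145]); the same on `emeryBoxLa214M15v122` and
`emeryBoxLa214M15` (mod-4's transfers). [cite: HybertsenSchluterChristensen1989, Eq. (1) (three-band d–p model)] -/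
theorem la214_M15_tp_sigmaFS_of_certificate :
    HoldsOn (fun p : EmeryCoord → ℝ => ∀ ε : ℝ,
        Emery.abFilling (p .DeltaPd) (p .tpd) (p .tpp) (p .tppP) ε = (2 - p .nHoles) / 2 →
        la214_M15_tp_sigmaFS.Mem (Emery.fsRatio (p .DeltaPd) (p .tpd) (p .tpp) (p .tppP) ε)) emeryBoxLa214M15v123 ∧
      HoldsOn (fun p : EmeryCoord → ℝ => ∀ ε : ℝ,
        Emery.abFilling (p .DeltaPd) (p .tpd) (p .tpp) (p .tppP) ε = (2 - p .nHoles) / 2 →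
        la214_M15_tp_sigmaFS.Mem (Emery.fsRatio (p .DeltaPd) (p .tpd) (p .tpp) (p .tppP) ε)) emeryBoxLa214M15v122 ∧
      HoldsOn (fun p : EmeryCoord → ℝ => ∀ ε : ℝ,
        Emery.abFilling (p .DeltaPd) (p .tpd) (p .tpp) (p .tppP) ε = (2 - p .nHoles) / 2 →
        la214_M15_tp_sigmaFS.Mem (Emery.fsRatio (p .DeltaPd) (p .tpd) (p .tpp) (p .tppP) ε)) emeryBoxLa214M15 := by
  have key : ∀ {ε' r : ℝ}, ε' ∈ Set.Icc (27 / 25 : ℝ) (62 / 25 : ℝ) ∧ r ∈ Set.Icc (-(741 / 2500 : ℝ)) (-(1661 / 10000 : ℝ)) →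
      la214_M15_tp_sigmaFS.Mem r := by
    intro ε' r hr
    refine (Entry.mem_ofEnds_iff _ _ _ _ _).2 ⟨?_, ?_⟩
    · have h1 := hr.2.1
      push_cast
      linarith
    · have h2 := hr.2.2
      push_cast
      linarith
  exact ⟨fun p hp ε hf => key (Emery.emeryBoxLa214M15v123_fsRatio_window p hp ε hf),
    fun p hp ε hf => key (Emery.emeryBoxLa214M15v122_fsRatio_window p hp ε hf),
    fun p hp ε hf => key (Emery.emeryBoxLa214M15_fsRatio_window p hp ε hf)⟩

/-! ## §2 The corner sub-boxes: both kernel words hold (the typed corner windows' overshoot of W13 is certificate slack, not realised) -/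

/-- **STRONG CORNER, BOTH WORDS** (raw coordinates; Δ_pd ∈ [1.7, 2.2] × t_pd ∈ [1.29, 1.40] × t_pp ∈ [0.60, 0.66] × t_pp′ ∈ [0.14, 0.15], per-spin filling ∈
[99/200, 101/200]): the σ-model FS ratio lies in SC (`Emery.emeryBoxLa214_strongCorner_fsRatio`) AND in W13 (`Emery.la214Box_fsRatio_window`, the corner being a
sub-box), hence in SC ∩ W13 = `[−591/2000, −1241/5000]` — and it IS an object-E value of the row of record and γ-admissible (part 4 §2). [folklore] -/
theorem la214_tp_sigmaFS_strongCorner_of_certificate {Δ tpd tpp c ε : ℝ} (hΔ : Δ ∈ Set.Icc (17 / 10 : ℝ) (11 / 5 : ℝ))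
    (ha : tpd ∈ Set.Icc (129 / 100 : ℝ) (7 / 5 : ℝ)) (hb : tpp ∈ Set.Icc (3 / 5 : ℝ) (33 / 50 : ℝ)) (hc : c ∈ Set.Icc (7 / 50 : ℝ) (3 / 20 : ℝ))
    (hν : Emery.abFilling Δ tpd tpp c ε ∈ Set.Icc (99 / 200 : ℝ) (101 / 200)) :
    la214_tp_sigmaFS_strongCorner.Mem (Emery.fsRatio Δ tpd tpp c ε) ∧ la214_M13_tp_sigmaFS.Mem (Emery.fsRatio Δ tpd tpp c ε) ∧
      (-(591 / 2000 : ℝ) ≤ Emery.fsRatio Δ tpd tpp c ε ∧ Emery.fsRatio Δ tpd tpp c ε ≤ -(1241 / 5000 : ℝ)) ∧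
      la214E_M13v19_tp.Mem (Emery.fsRatio Δ tpd tpp c ε) ∧ la214G_tp_row.Mem (Emery.fsRatio Δ tpd tpp c ε) := by
  have hSC := (Emery.emeryBoxLa214_strongCorner_fsRatio hΔ ha hb hc hν).2
  have hW := Emery.la214Box_fsRatio_window ⟨hΔ.1, hΔ.2.trans (by norm_num)⟩ ⟨ha.1, ha.2.trans (by norm_num)⟩
    ⟨le_trans (by norm_num) hb.1, hb.2⟩ ⟨le_trans (by norm_num) hc.1, hc.2⟩ hν
  have hSC' : la214_tp_sigmaFS_strongCorner.Mem (Emery.fsRatio Δ tpd tpp c ε) := by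
    refine (Entry.mem_ofEnds_iff _ _ _ _ _).2 ⟨?_, ?_⟩
    · have h1 := hSC.1
      push_cast
      linarith
    · have h2 := hSC.2
      push_cast
      linarith
  have hW' : la214_M13_tp_sigmaFS.Mem (Emery.fsRatio Δ tpd tpp c ε) := by
    refine (Entry.mem_ofEnds_iff _ _ _ _ _).2 ⟨?_, ?_⟩
    · have h1 := hW.1
      push_cast
      linarith
    · have h2 := hW.2
      push_cast
      linarith
  obtain ⟨hE, hG⟩ := la214_tp_sigmaFS_strongCorner_placement.1 _ hSC'
  exact ⟨hSC', hW', ⟨by linarith [hW.1], by linarith [hSC.2]⟩, hE, hG⟩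

/-- **WEAK CORNER, BOTH WORDS** (Δ_pd ∈ [3.5, 4.0] × t_pd ∈ [1.40, 1.52] × t_pp ∈ [0.46, 0.50] × t_pp′ ∈ [0.12, 0.13], per-spin filling ∈ [99/200, 101/200]): the
σ-model FS ratio lies in WC (`Emery.emeryBoxLa214_weakCorner_fsRatio`) AND in W13, hence in WC ∩ W13 = `[−197/1000, −1653/10000]`; it is NOT an object-E value
(mod-4's `…_weakCorner_not_objectE`, recovered through part 4 §2) but IS γ-admissible, and it lies in the literature object-M row `[−9/50, −3/50]` exactly
when it is `≥ −9/50`. [folklore] -/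
theorem la214_tp_sigmaFS_weakCorner_of_certificate {Δ tpd tpp c ε : ℝ} (hΔ : Δ ∈ Set.Icc (7 / 2 : ℝ) (4 : ℝ))
    (ha : tpd ∈ Set.Icc (7 / 5 : ℝ) (38 / 25 : ℝ)) (hb : tpp ∈ Set.Icc (23 / 50 : ℝ) (1 / 2 : ℝ)) (hc : c ∈ Set.Icc (3 / 25 : ℝ) (13 / 100 : ℝ))
    (hν : Emery.abFilling Δ tpd tpp c ε ∈ Set.Icc (99 / 200 : ℝ) (101 / 200)) :
    la214_tp_sigmaFS_weakCorner.Mem (Emery.fsRatio Δ tpd tpp c ε) ∧ la214_M13_tp_sigmaFS.Mem (Emery.fsRatio Δ tpd tpp c ε) ∧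
      (-(197 / 1000 : ℝ) ≤ Emery.fsRatio Δ tpd tpp c ε ∧ Emery.fsRatio Δ tpd tpp c ε ≤ -(1653 / 10000 : ℝ)) ∧
      ¬ la214E_M13v19_tp.Mem (Emery.fsRatio Δ tpd tpp c ε) ∧ la214G_tp_row.Mem (Emery.fsRatio Δ tpd tpp c ε) ∧
      ((((la214M_tp_lit_row.fst : ℚ) : ℝ) ≤ Emery.fsRatio Δ tpd tpp c ε ∧ Emery.fsRatio Δ tpd tpp c ε ≤ ((la214M_tp_lit_row.snd : ℚ) : ℝ)) ↔
        -(9 / 50 : ℝ) ≤ Emery.fsRatio Δ tpd tpp c ε) := by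
  have hWC := (Emery.emeryBoxLa214_weakCorner_fsRatio hΔ ha hb hc hν).2
  have hW := Emery.la214Box_fsRatio_window ⟨le_trans (by norm_num) hΔ.1, hΔ.2⟩ ⟨le_trans (by norm_num) ha.1, ha.2⟩
    ⟨hb.1, hb.2.trans (by norm_num)⟩ ⟨hc.1, hc.2.trans (by norm_num)⟩ hν
  have hWC' : la214_tp_sigmaFS_weakCorner.Mem (Emery.fsRatio Δ tpd tpp c ε) := by
    refine (Entry.mem_ofEnds_iff _ _ _ _ _).2 ⟨?_, ?_⟩
    · have h1 := hWC.1
      push_cast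
      linarith
    · have h2 := hWC.2
      push_cast
      linarith
  have hW' : la214_M13_tp_sigmaFS.Mem (Emery.fsRatio Δ tpd tpp c ε) := by
    refine (Entry.mem_ofEnds_iff _ _ _ _ _).2 ⟨?_, ?_⟩
    · have h1 := hW.1
      push_cast
      linarith
    · have h2 := hW.2
      push_cast
      linarith
  obtain ⟨hE, hG⟩ := la214_tp_sigmaFS_weakCorner_placement.1 _ hWC'
  exact ⟨hWC', hW', ⟨by linarith [hWC.1], by linarith [hW.2]⟩, hE, hG, (la214_tp_sigmaFS_weakCorner_placement.2.2.1 _ hWC').1⟩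

/-! ## §3 The words on the ladder rows: γ-admissible always; object E iff `≤ −1/5`; never in the FLOOR sliver or at the station -/

/-- **ON THE WHOLE COMPANION AT n_H = 1** (both filling forms are equivalent; stated in the hole-count form): for every parameter vector of `emeryBoxLa214v123` and
every Fermi energy carrying n_H = 1, the σ-model Fermi-surface ratio `r` (i) lies in the γ row of record `la214G_tp_row = [−33/100, −4/25]`; (ii) is a value of the
object-E row of record `la214E_M13v19_tp = [−3/10, −1/5]` IFF `r ≤ −1/5`; (iii) satisfies `−591/2000 ≤ r`, so it never lies in the row's FLOOR sliver
`[−3/10, −591/2000)` and never equals the M2(b) station value `−3/10`. One composition of the W13 tie with part 4 §1/§3. [folklore] -/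
theorem la214_tp_sigmaFS_rows_of_certificate :
    HoldsOn (fun p : EmeryCoord → ℝ => ∀ ε : ℝ,
      Emery.abFilling (p .DeltaPd) (p .tpd) (p .tpp) (p .tppP) ε = (2 - p .nHoles) / 2 →
      la214G_tp_row.Mem (Emery.fsRatio (p .DeltaPd) (p .tpd) (p .tpp) (p .tppP) ε) ∧
        (la214E_M13v19_tp.Mem (Emery.fsRatio (p .DeltaPd) (p .tpd) (p .tpp) (p .tppP) ε) ↔
          Emery.fsRatio (p .DeltaPd) (p .tpd) (p .tpp) (p .tppP) ε ≤ -(1 / 5 : ℝ)) ∧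
        -(591 / 2000 : ℝ) ≤ Emery.fsRatio (p .DeltaPd) (p .tpd) (p .tpp) (p .tppP) ε ∧
        Emery.fsRatio (p .DeltaPd) (p .tpd) (p .tpp) (p .tppP) ε ≠ -(3 / 10 : ℝ)) emeryBoxLa214v123 := by
  intro p hp ε hf
  have hW := la214_M13_tp_sigmaFS_of_certificate p hp ε hf
  have hW' := hW
  rw [la214_M13_tp_sigmaFS, Entry.mem_ofEnds_iff'] at hW'
  obtain ⟨h1, -⟩ := hW'
  push_cast at h1
  refine ⟨la214_tp_sigmaFS_inside_gamma.1 _ hW, la214_tp_sigmaFS_vs_objectE_row.2.1 _ hW, by linarith, fun h => ?_⟩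
  rw [h] at h1
  norm_num at h1

/-- **ON THE x = 1/8 BOX**: for every parameter vector of `emeryBoxLa214M15v123` and every Fermi energy carrying its electron count, the σ-model FS ratio lies in the
γ row and is a value of the M15 object-E row `la214E_M15v19_tp = [−3/10, −1/5]` IFF it is `≤ −1/5`; it is always `≥ −741/2500 > −3/10`. [folklore] -/
theorem la214_tp_sigmaFS_rowsM15_of_certificate :
    HoldsOn (fun p : EmeryCoord → ℝ => ∀ ε : ℝ,
      Emery.abFilling (p .DeltaPd) (p .tpd) (p .tpp) (p .tppP) ε = (2 - p .nHoles) / 2 →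
      la214G_tp_row.Mem (Emery.fsRatio (p .DeltaPd) (p .tpd) (p .tpp) (p .tppP) ε) ∧
        (la214E_M15v19_tp.Mem (Emery.fsRatio (p .DeltaPd) (p .tpd) (p .tpp) (p .tppP) ε) ↔
          Emery.fsRatio (p .DeltaPd) (p .tpd) (p .tpp) (p .tppP) ε ≤ -(1 / 5 : ℝ)) ∧
        -(741 / 2500 : ℝ) ≤ Emery.fsRatio (p .DeltaPd) (p .tpd) (p .tpp) (p .tppP) ε) emeryBoxLa214M15v123 := by
  intro p hp ε hf
  have hW := la214_M15_tp_sigmaFS_of_certificate.1 p hp ε hf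
  have hW' := hW
  rw [la214_M15_tp_sigmaFS, Entry.mem_ofEnds_iff'] at hW'
  obtain ⟨h1, h2⟩ := hW'
  push_cast at h1 h2
  refine ⟨la214_tp_sigmaFS_inside_gamma.2.1 _ hW, ?_, by linarith⟩
  rw [la214E_M15v19_tp, Entry.mem_ofEnds_iff']
  push_cast
  exact ⟨fun h => by linarith [h.2], fun h => ⟨by linarith, by linarith⟩⟩

/-- **All box-level ties in one line** (citable): the kernel windows of `EmeryFermiFillingLa214` / `EmeryFermiFillingLSCO` ARE part 4's entries W13 / W15.
[folklore] -/
theorem la214_tp_sigmaFS_of_certificates :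
    HoldsOn (fun p : EmeryCoord → ℝ => ∀ ε : ℝ,
        Emery.abFilling (p .DeltaPd) (p .tpd) (p .tpp) (p .tppP) ε = (2 - p .nHoles) / 2 →
        la214_M13_tp_sigmaFS.Mem (Emery.fsRatio (p .DeltaPd) (p .tpd) (p .tpp) (p .tppP) ε)) emeryBoxLa214v123 ∧
      HoldsOn (fun p : EmeryCoord → ℝ => ∀ ε : ℝ,
        Emery.abFilling (p .DeltaPd) (p .tpd) (p .tpp) (p .tppP) ε = (2 - p .nHoles) / 2 →
        la214_M15_tp_sigmaFS.Mem (Emery.fsRatio (p .DeltaPd) (p .tpd) (p .tpp) (p .tppP) ε)) emeryBoxLa214M15v123 :=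
  ⟨la214_M13_tp_sigmaFS_of_certificate, la214_M15_tp_sigmaFS_of_certificate.1⟩

end Summit.Ventures.CertifiedManyBodySolver.Downfold

end
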